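import Summits.QuantumFields.QCD.Theorems.SpectralDefectExtinctionWindowExtinctionStubBoxBlockReindex
import HarnessLib

/-!
# Cutting the box block down to the periodic torus (stub `stub_boxBlockCut`)

Stub `stub_boxBlockCut` (S10) of line `free-volume-heavy-witness` (reshape r4) of crux
`Summit.QuantumFields.QCD.Theses.SpectralDefectExtinction.WindowExtinction`
(item stmt-QuantumFields-8964).

Let `U₀` be a PERIODIC `SU(3)` gauge field on the odd four-torus of side `2R+1`, with Hermitian
Wilson–Dirac operator `H_per = Γ₅ D_W(U₀, −δ, 1)` on the quark indices
`TorusSite 4 (2R+1) × Fin 3 × Fin 4`, and let `U` be a gauge field on a big four-torus of side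
`n > 2R+1` whose content in the box `c + {−R, …, R}⁴` is the link field of `U₀`:
`U(proj n (c + y), μ) = U₀(proj (2R+1) y, μ)`.  Let `H_box` be the principal block of
`Γ₅ D_W(U, −δ, 1)` over the quark indices of the image of the box.  The stub:
`n₋(H_per) ≤ n₋(H_box) + 12 ((2R+1)⁴ − (2R−1)⁴)`.

* `cut_proj_inj_iff`, `cut_exists_torusParam` — the box `{−R, …, R}⁴` is a complete residue
  system mod `2R+1`, so both index sets are parametrised by `box 4 R × (Fin 3 × Fin 4)`
  (`reindex_exists_boxParam` for the big torus);
* `cut_proj_eq_shift_iff` — NO WRAP-AROUND between STRICTLY INTERIOR box points (`|y_k| < R`) on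
  the small torus: they lie in the box of radius `R − 1` and `2(R−1)+1 < 2R+1`
  (`reindex_proj_add_eq_shift_iff`); hence (`cut_entry_congr`) an entry of `H_box` between two
  indices over interior points equals the corresponding entry of `H_per` — the incidence data of the
  two sites agree on both tori and the links read agree by hypothesis;
* `cut_exists_faces` — the indices over the non-interior ("face") points number at most
  `12 ((2R+1)⁴ − (2R−1)⁴)`;
* `cut_negRootCount_le` — rank slack (`inertia_negRootCount_le_add_card`): two Hermitian forms that
  agree on the vectors vanishing on the face indices have negative counts differing by at most the
  number of face indices; `n₋` is invariant under re-indexing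
  (`inertia_negRootCount_submatrix_equiv`).

References: Horn–Johnson, *Matrix Analysis* (1985), §4.3 (rank perturbations / interlacing).
-/

noncomputable section

namespace Summit.QuantumFields.QCD.Cruxes.WindowExtinction.FreeVolumeHeavyWitness

open Matrix
open Literature.MathematicalPhysics.QuantumLattice Literature.MathematicalPhysics.QuantumFieldTheory
  Literature.Probability.LatticeModels
open Literature.MathematicalPhysics (QuantumFieldTheory.Site.shift)
open Summit.QuantumFields.QCD.Theorems.ExtinctionBuildsQCD.Negative
open scoped BigOperators Classical

/-! ## The box `{−R, …, R}^d` as a fundamental domain of the torus of side `2R+1` -/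

/-- **The box is a complete residue system (injectivity).**  Two points of `{−R, …, R}^d` with the
same image on the torus of side `2R+1` are equal (`reindex_proj_add_inj_iff` with `c = 0`). -/
theorem cut_proj_inj_iff {d R : ℕ} {y y' : Fin d → ℤ} (hy : y ∈ box d R) (hy' : y' ∈ box d R) :
    Torus.proj (2 * R + 1) y = Torus.proj (2 * R + 1) y' ↔ y = y' := by
  have h := reindex_proj_add_inj_iff (n := 2 * R + 1) le_rfl 0 hy hy'
  simpa only [zero_add] using h

/-- A strictly interior point of the box of radius `R' + 1` (all `|y_k| < R' + 1`) lies in the box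
of radius `R'`. -/
theorem cut_mem_box_of_interior {d R' : ℕ} {y : Fin d → ℤ}
    (hy : ∀ k, |y k| < ((R' + 1 : ℕ) : ℤ)) : y ∈ box d R' := by
  rw [mem_box]
  intro k
  have h := hy k
  push_cast at h
  rw [abs_lt] at h
  constructor <;> omega

/-- **No wrap-around between strictly interior points.**  For strictly interior points `y, y'`
(`|y_k|, |y'_k| < R` for all `k`), the image of `y'` on the torus of side `2R+1` is the forward
`μ`-neighbour of the image of `y` iff `y' = y + e_μ` in `ℤ^d`: both points lie in the box of radius
`R − 1` and `2(R−1)+1 < 2R+1` (`reindex_proj_add_eq_shift_iff` with `c = 0`). -/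
theorem cut_proj_eq_shift_iff {d R : ℕ} {y y' : Fin d → ℤ} (hy : ∀ k, |y k| < (R : ℤ))
    (hy' : ∀ k, |y' k| < (R : ℤ)) (μ : Fin d) :
    Torus.proj (2 * R + 1) y' = QuantumFieldTheory.Site.shift (Torus.proj (2 * R + 1) y) μ ↔
      y' = y + Pi.single μ 1 := by
  obtain ⟨R', rfl⟩ : ∃ R', R = R' + 1 := by
    have h0 : (0 : ℤ) < R := (abs_nonneg _).trans_lt (hy μ)
    exact ⟨R - 1, by omega⟩
  have h := reindex_proj_add_eq_shift_iff (n := 2 * (R' + 1) + 1) (R := R') (by omega) 0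
    (cut_mem_box_of_interior hy) (cut_mem_box_of_interior hy') μ
  simpa only [zero_add] using h

/-- **The quark indices of the periodic torus are parametrised by the box.**  The map
`(y, s) ↦ (proj (2R+1) y, s)` is a bijection from `box 4 R × ι` onto `TorusSite 4 (2R+1) × ι`:
injective by `cut_proj_inj_iff`, and both sides have `(2R+1)⁴ · #ι` elements (`card_box`,
`ZMod.card`). -/
theorem cut_exists_torusParam {ι : Type*} [Fintype ι] (R : ℕ) :
    ∃ e : ↥(box 4 R) × ι ≃ TorusSite 4 (2 * R + 1) × ι,
      ∀ t, e t = (Torus.proj (2 * R + 1) (t.1 : Fin 4 → ℤ), t.2) := by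
  have hbij : Function.Bijective
      (fun t : ↥(box 4 R) × ι => (Torus.proj (2 * R + 1) (t.1 : Fin 4 → ℤ), t.2)) := by
    rw [Fintype.bijective_iff_injective_and_card]
    constructor
    · rintro ⟨y, s⟩ ⟨y', s'⟩ h
      simp only [Prod.mk.injEq] at h
      exact Prod.ext (Subtype.ext ((cut_proj_inj_iff y.2 y'.2).1 h.1)) h.2
    · simp only [Fintype.card_prod, Fintype.card_coe, card_box, Fintype.card_pi, ZMod.card,
        Finset.prod_const, Finset.card_univ, Fintype.card_fin]
  exact ⟨Equiv.ofBijective _ hbij, fun t => rfl⟩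

/-- **The face indices.**  There is a set `K` of quark indices `(y, s)`, `y ∈ box 4 R`,
`s ∈ Fin 3 × Fin 4`, containing every index over a box point that is NOT strictly interior (some
`|y_k| = R`), with `#K + 12 (2R−1)⁴ ≤ 12 (2R+1)⁴`: the strictly interior points contain the box of
radius `R − 1` (for `R ≥ 1`; for `R = 0` the bound reads `#K ≤ 12`). -/
theorem cut_exists_faces (R : ℕ) :
    ∃ K : Finset (↥(box 4 R) × (Fin 3 × Fin 4)),
      (∀ t, t ∉ K → ∀ k, |(t.1 : Fin 4 → ℤ) k| < (R : ℤ)) ∧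
      K.card + 12 * (2 * R - 1) ^ 4 ≤ 12 * (2 * R + 1) ^ 4 := by
  refine ⟨Finset.univ.filter fun t => ¬ ∀ k, |(t.1 : Fin 4 → ℤ) k| < (R : ℤ),
    fun t ht => ?_, ?_⟩
  · simpa only [Finset.mem_filter, Finset.mem_univ, true_and, not_not] using ht
  · -- complementary counting: interior + faces = all `12 (2R+1)⁴` indices
    have hsum : (Finset.univ.filter fun t : ↥(box 4 R) × (Fin 3 × Fin 4) =>
          ∀ k, |(t.1 : Fin 4 → ℤ) k| < (R : ℤ)).card +
        (Finset.univ.filter fun t : ↥(box 4 R) × (Fin 3 × Fin 4) =>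
          ¬ ∀ k, |(t.1 : Fin 4 → ℤ) k| < (R : ℤ)).card = 12 * (2 * R + 1) ^ 4 := by
      rw [Finset.card_filter_add_card_filter_not, Finset.card_univ, Fintype.card_prod,
        Fintype.card_coe, card_box, Fintype.card_prod, Fintype.card_fin, Fintype.card_fin]
      ring
    -- the interior indices contain (the image of) `box 4 (R-1) × (Fin 3 × Fin 4)`
    have hint : 12 * (2 * R - 1) ^ 4 ≤
        (Finset.univ.filter fun t : ↥(box 4 R) × (Fin 3 × Fin 4) =>
          ∀ k, |(t.1 : Fin 4 → ℤ) k| < (R : ℤ)).card := by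
      rcases Nat.eq_zero_or_pos R with rfl | hR
      · simp
      · obtain ⟨R', rfl⟩ : ∃ R', R = R' + 1 := ⟨R - 1, by omega⟩
        have hinj : Function.Injective
            (fun t : ↥(box 4 (R' + 1)) × (Fin 3 × Fin 4) => ((t.1 : Fin 4 → ℤ), t.2)) := by
          rintro ⟨y, s⟩ ⟨y', s'⟩ h
          simp only [Prod.mk.injEq] at h
          exact Prod.ext (Subtype.ext h.1) h.2
        have hsub : box 4 R' ×ˢ (Finset.univ : Finset (Fin 3 × Fin 4)) ⊆
            (Finset.univ.filter fun t : ↥(box 4 (R' + 1)) × (Fin 3 × Fin 4) =>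
              ∀ k, |(t.1 : Fin 4 → ℤ) k| < ((R' + 1 : ℕ) : ℤ)).image
              (fun t => ((t.1 : Fin 4 → ℤ), t.2)) := by
          rintro ⟨y, s⟩ hx
          rw [Finset.mem_product] at hx
          rw [Finset.mem_image]
          refine ⟨(⟨y, box_mono 4 (Nat.le_succ R') hx.1⟩, s), ?_, rfl⟩
          rw [Finset.mem_filter]
          refine ⟨Finset.mem_univ _, fun k => ?_⟩
          show |y k| < ((R' + 1 : ℕ) : ℤ)
          have h := spread_abs_le_of_mem_box hx.1 k
          push_cast
          linarith
        have h1 := Finset.card_le_card hsub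
        rw [Finset.card_image_of_injective _ hinj, Finset.card_product, card_box, Finset.card_univ,
          Fintype.card_prod, Fintype.card_fin, Fintype.card_fin] at h1
        have h2 : 2 * (R' + 1) - 1 = 2 * R' + 1 := by omega
        rw [h2]
        linarith
    omega

/-! ## Interior entries of the box block -/

/-- **Interior entries of the box block are entries of the periodic operator.**  If the box content
of `U` (four-torus of side `n > 2R+1`, box about `c`) is the link field of the periodic
configuration `U₀` on the four-torus of side `2R+1`, then for strictly interior box points `y, y'`
the entry of `Γ₅ D_W(U, m, r)` between the quark indices over `proj n (c + y)`, `proj n (c + y')`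
equals the entry of `Γ₅ D_W(U₀, m, r)` between those over `proj (2R+1) y`, `proj (2R+1) y'`: the
incidence data of the two sites agree (no wrap-around on either torus: `reindex_proj_add_inj_iff`,
`reindex_proj_add_eq_shift_iff`, `cut_proj_inj_iff`, `cut_proj_eq_shift_iff`) and the links read
agree (`reindex_hermitianWilson_congr`). -/
theorem cut_entry_congr {R n : ℕ} [NeZero n] (hn : 2 * R + 1 < n) (c : Fin 4 → ℤ)
    {U₀ : GaugeConfig 4 (2 * R + 1) SU3} {U : GaugeConfig 4 n SU3}
    (hU : ∀ (y : ↥(box 4 R)) (μ : Fin 4),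
      U (Torus.proj n (c + (y : Fin 4 → ℤ)), μ) = U₀ (Torus.proj (2 * R + 1) (y : Fin 4 → ℤ), μ))
    (m r : ℝ) {y y' : Fin 4 → ℤ} (hy : y ∈ box 4 R) (hy' : y' ∈ box 4 R)
    (hyi : ∀ k, |y k| < (R : ℤ)) (hy'i : ∀ k, |y' k| < (R : ℤ)) (s t : Fin 3 × Fin 4) :
    (spinorLift (L := n) (N := 3) gammaFive * wilsonDirac (fundamentalRep (Fin 3)) U m r)
        (Torus.proj n (c + y), s) (Torus.proj n (c + y'), t) =
      (spinorLift (L := 2 * R + 1) (N := 3) gammaFive * wilsonDirac (fundamentalRep (Fin 3)) U₀ m r)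
        (Torus.proj (2 * R + 1) y, s) (Torus.proj (2 * R + 1) y', t) :=
  reindex_hermitianWilson_congr (fundamentalRep (Fin 3)) m r s t
    (by rw [reindex_proj_add_inj_iff hn.le c hy hy', cut_proj_inj_iff hy hy'])
    (fun μ => by
      rw [reindex_proj_add_eq_shift_iff hn c hy' hy μ, cut_proj_eq_shift_iff hy'i hyi μ])
    (fun μ => by
      rw [reindex_proj_add_eq_shift_iff hn c hy hy' μ, cut_proj_eq_shift_iff hyi hy'i μ])
    (fun μ => hU ⟨y, hy⟩ μ) (fun μ => hU ⟨y', hy'⟩ μ)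

/-! ## Rank slack along two parametrisations -/

/-- If two matrices agree at all entries `(p, q)` with `p, q ∉ K`, then their forms
`v ↦ ⟨v, M v⟩` agree on every vector vanishing on `K`. -/
theorem cut_form_congr {k : Type*} [Fintype k] {M M' : Matrix k k ℂ} (K : Finset k)
    (h : ∀ p q, p ∉ K → q ∉ K → M' p q = M p q) (v : k → ℂ) (hv : ∀ q ∈ K, v q = 0) :
    star v ⬝ᵥ (M' *ᵥ v) = star v ⬝ᵥ (M *ᵥ v) := by
  simp only [dotProduct, mulVec, Pi.star_apply]
  refine Finset.sum_congr rfl fun p _ => ?_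
  by_cases hp : p ∈ K
  · rw [hv p hp, star_zero, zero_mul, zero_mul]
  · congr 1
    refine Finset.sum_congr rfl fun q _ => ?_
    by_cases hq : q ∈ K
    · rw [hv q hq, mul_zero, mul_zero]
    · rw [h p q hp hq]

/-- **Abstract cut (rank slack along two parametrisations).**  Let `A` (on `ι`) and `B` (on `ι'`)
be Hermitian, `e : k ≃ ι` and `f : k ≃ ι'` parametrisations by a common index set `k`, and `K` a
finite set of common indices off which the entries agree: `B (f p) (f q) = A (e p) (e q)` for
`p, q ∉ K`.  Then `n₋(A) ≤ n₋(B) + #K`: the re-indexed matrices have forms agreeing on the vectors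
vanishing on `K` (`cut_form_congr`, `inertia_negRootCount_le_add_card`), and `n₋` is invariant
under re-indexing (`inertia_negRootCount_submatrix_equiv`). -/
theorem cut_negRootCount_le {k ι ι' : Type*} [Fintype k] [DecidableEq k] [Fintype ι]
    [DecidableEq ι] [Fintype ι'] [DecidableEq ι'] {A : Matrix ι ι ℂ} {B : Matrix ι' ι' ℂ}
    (hA : A.IsHermitian) (hB : B.IsHermitian) (e : k ≃ ι) (f : k ≃ ι') (K : Finset k)
    (h : ∀ p q, p ∉ K → q ∉ K → B (f p) (f q) = A (e p) (e q)) :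
    negRootCount A ≤ negRootCount B + K.card := by
  have h1 := inertia_negRootCount_le_add_card (hA.submatrix e) (hB.submatrix f) K (fun v hv =>
    cut_form_congr K (fun p q hp hq => by simpa only [submatrix_apply] using h p q hp hq) v hv)
  rwa [inertia_negRootCount_submatrix_equiv, inertia_negRootCount_submatrix_equiv] at h1

/-! ## The stub -/

/-- **STUB S10 `stub_boxBlockCut` (cutting the box block down to the periodic torus).**  Let `U₀`
be an `SU(3)` gauge field on the odd four-torus of side `2R+1` and `U` a gauge field on the
four-torus of side `n > 2R+1` whose content in the box `c + {−R, …, R}⁴` is the link field of `U₀`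
(`U(proj n (c + y), μ) = U₀(proj (2R+1) y, μ)`).  Then for every `δ` the negative count of the
periodic Hermitian Wilson–Dirac operator `Γ₅ D_W(U₀, −δ, 1)` is at most the negative count of the
box block of `Γ₅ D_W(U, −δ, 1)` plus `12 ((2R+1)⁴ − (2R−1)⁴)` (the number of quark indices over
the faces of the box).  Proof: along the parametrisations of both index sets by
`box 4 R × (Fin 3 × Fin 4)` (`cut_exists_torusParam`, `reindex_exists_boxParam`) the two operators
have the same entries between indices over strictly interior box points (`cut_entry_congr`: the
only entries of the periodic operator the box block lacks are the wrap-around hoppings between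
opposite faces), so their forms agree on the vectors vanishing on the face indices
(`cut_exists_faces`), and the rank slack `cut_negRootCount_le` applies. -/
theorem stub_boxBlockCut :
    ∀ (R : ℕ) (U₀ : GaugeConfig 4 (2 * R + 1) SU3) (δ : ℝ) (n : ℕ) [NeZero n], 2 * R + 1 < n →
      ∀ (c : Fin 4 → ℤ) (U : GaugeConfig 4 n SU3),
        (∀ (y : ↥(box 4 R)) (μ : Fin 4),
          U (Torus.proj n (c + (y : Fin 4 → ℤ)), μ) = U₀ (Torus.proj (2 * R + 1) (y : Fin 4 → ℤ), μ)) →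
        negRootCount (spinorLift gammaFive * wilsonDirac (fundamentalRep (Fin 3)) U₀ (-δ) 1) ≤
          negRootCount ((spinorLift gammaFive * wilsonDirac (fundamentalRep (Fin 3)) U (-δ) 1).submatrix
              (Subtype.val : {p : TorusSite 4 n × Fin 3 × Fin 4 //
                ∃ y : ↥(box 4 R), Torus.proj n (c + (y : Fin 4 → ℤ)) = p.1} → _) Subtype.val) +
            12 * ((2 * R + 1) ^ 4 - (2 * R - 1) ^ 4) := by
  intro R U₀ δ n _ hn c U hU
  -- Hermiticity of the periodic operator and of the box block (γ₅-hermiticity, unitary colour rep)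
  have hA : (spinorLift gammaFive * wilsonDirac (fundamentalRep (Fin 3)) U₀ (-δ) 1).IsHermitian :=
    Literature.Barriers.QuantumFields.WilsonDeterminant.isHermitian_hermitianWilsonDirac _
      fundamentalRep_mem_unitaryGroup U₀ (-δ) 1
  have hB : ((spinorLift gammaFive * wilsonDirac (fundamentalRep (Fin 3)) U (-δ) 1).submatrix
      (Subtype.val : {p : TorusSite 4 n × Fin 3 × Fin 4 //
        ∃ y : ↥(box 4 R), Torus.proj n (c + (y : Fin 4 → ℤ)) = p.1} → _) Subtype.val).IsHermitian :=
    (Literature.Barriers.QuantumFields.WilsonDeterminant.isHermitian_hermitianWilsonDirac _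
      fundamentalRep_mem_unitaryGroup U (-δ) 1).submatrix _
  -- the two parametrisations by `box 4 R × (colour × spin)` and the face indices
  obtain ⟨e, he⟩ := cut_exists_torusParam (ι := Fin 3 × Fin 4) R
  obtain ⟨f, hf⟩ := reindex_exists_boxParam (ι := Fin 3 × Fin 4) hn.le c
  obtain ⟨K, hKmem, hKcard⟩ := cut_exists_faces R
  -- rank slack: the entries agree off the face indices
  have key := cut_negRootCount_le hA hB e f K (fun p q hp hq => by
    simp only [submatrix_apply, hf, he]
    exact cut_entry_congr hn c hU (-δ) 1 p.1.2 q.1.2 (hKmem p hp) (hKmem q hq) p.2 q.2)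
  omega

end Summit.QuantumFields.QCD.Cruxes.WindowExtinction.FreeVolumeHeavyWitness

end
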